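import Summits.AtomisticToContinuum.HydrodynamicLimit.Theorems.InformationPercolationEngineChaosClosesEulerDissipationRigidityA
import Mathlib.Analysis.Analytic.IsolatedZeros
import Mathlib.Analysis.Complex.CauchyIntegral
import Mathlib.Analysis.Complex.Convex
import Mathlib.Analysis.Calculus.ParametricIntegral
import Mathlib.MeasureTheory.Group.IntegralConvolution
import Mathlib.MeasureTheory.Measure.CharacteristicFunction.Basic
import HarnessLib

/-!
# Dissipation rigidity — D: injectivity of the Gaussian coarse-graining (heat deconvolution)

Helper for the line `empirical-h-theorem` of the crux `InformationPercolationEngine.ChaosClosesEuler`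
(stmt-AtomisticToContinuum-15141), registered stub `stub_dissipationRigidity`.

**Heat deconvolution lemma** (`eq_zero_of_gaussian_conv_eq_zero`): a continuous `F : ℝ³ → ℝ` of quadratic
growth whose Gaussian coarse-graining `∫ φδ(v − u) F(u) du` vanishes for every `v` is identically zero.
Proof, inside Mathlib:

* the isotropic Gaussian laws form a convolution semigroup, `N(v, s) ∗ N(0, t) = N(v, s + t)`
  (characteristic functions, `Measure.ext_of_charFun`), so the pairings `s ↦ ∫ F dN(v, s)` vanish for all
  `s ≥ δ²` (`integral_conv`);
* in the variable `ρ = 1/s` the unnormalised pairing `G_v(ρ) = ∫ F(u) e^{−ρ|u−v|²/2} du` extends to a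
  holomorphic function on the right half-plane (differentiation under the integral sign,
  `hasDerivAt_integral_of_dominated_loc_of_deriv_le`, Gaussian-times-polynomial domination), which vanishes
  on the real segment `(0, δ⁻²]`, hence identically (identity theorem,
  `AnalyticOnNhd.eqOn_zero_of_preconnected_of_frequently_eq_zero`): the pairings vanish for ALL `s > 0`;
* `∫ F dN(v, s) → F(v)` as `s → 0⁺` (dominated convergence after `u = v + √s w`), so `F(v) = 0`.

References: folklore (Weierstrass transform / backward uniqueness for the heat semigroup on tempered data).
-/

noncomputable section

namespace Summit.AtomisticToContinuum.HydrodynamicLimit.Theorems.ChaosClosesEulerDissipationRigidity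

open scoped BigOperators Topology Classical MeasureTheory ENNReal InnerProductSpace
open Filter Set MeasureTheory ProbabilityTheory Complex
open Literature.MathematicalPhysics.KineticTheory
open Literature.Analysis.FluidPDE
open Summit.AtomisticToContinuum.HydrodynamicLimit.Theorems

/-! ## The Gaussian convolution semigroup -/

/-- **Characteristic function of the isotropic Gaussian**:
`𝔼 e^{i⟨X, ξ⟩} = e^{−θ|ξ|²/2} e^{i⟨u, ξ⟩}` for `X ∼ N(u, θ id)`, `θ ≥ 0`. [folklore] -/
theorem charFun_gaussMeasure (u : V3) {θ : ℝ} (hθ : 0 ≤ θ) (ξ : V3) :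
    charFun (gaussMeasure u θ) ξ = cexp (-((θ * ‖ξ‖ ^ 2 / 2 : ℝ) : ℂ)) * cexp ((⟪u, ξ⟫_ℝ : ℂ) * I) := by
  rw [gaussMeasure_eq_map_map, charFun_map_const_add, charFun_map_smul, charFun_stdGaussian,
    norm_smul, Real.norm_eq_abs, abs_of_nonneg (Real.sqrt_nonneg θ)]
  have h : (Real.sqrt θ * ‖ξ‖) ^ 2 = θ * ‖ξ‖ ^ 2 := by rw [mul_pow, Real.sq_sqrt hθ]
  congr 2
  rw [← Complex.ofReal_pow, h]
  push_cast
  ring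

/-- Translating the centred isotropic Gaussian: `(x + ·)_* N(0, θ) = N(x, θ)`. [folklore] -/
theorem gaussMeasure_map_const_add (x : V3) (θ : ℝ) :
    (gaussMeasure (0 : V3) θ).map (fun y => x + y) = gaussMeasure x θ := by
  rw [gaussMeasure, gaussMeasure, Measure.map_map (measurable_const_add x) (measurable_gaussShift 0 θ)]
  congr 1
  funext w
  simp only [Function.comp_apply, zero_add]

/-- **The Gaussian convolution semigroup**: `N(u, s) ∗ N(0, t) = N(u, s + t)` (`s, t ≥ 0`). [folklore] -/
theorem gaussMeasure_conv_gaussMeasure (u : V3) {s t : ℝ} (hs : 0 ≤ s) (ht : 0 ≤ t) :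
    gaussMeasure u s ∗ gaussMeasure (0 : V3) t = gaussMeasure u (s + t) := by
  refine Measure.ext_of_charFun (funext fun ξ => ?_)
  rw [charFun_conv, charFun_gaussMeasure u hs, charFun_gaussMeasure 0 ht,
    charFun_gaussMeasure u (add_nonneg hs ht), inner_zero_left]
  simp only [← Complex.exp_add]
  congr 1
  push_cast
  ring

/-- A continuous function of quadratic growth is integrable under every isotropic Gaussian. [folklore] -/
theorem integrable_gaussMeasure_of_quad {F : V3 → ℝ} (hFc : Continuous F) {C : ℝ}
    (hC : ∀ u, |F u| ≤ C * (1 + ‖u‖ ^ 2)) (u : V3) (θ : ℝ) : Integrable F (gaussMeasure u θ) := by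
  refine ((integrable_one_add_norm_sq_pow_gaussMeasure u θ 1).const_mul C).mono' hFc.aestronglyMeasurable
    (Eventually.of_forall fun w => ?_)
  rw [Real.norm_eq_abs, pow_one]
  exact hC w

/-- **Vanishing pairings propagate to larger variances**: if `∫ F dN(v, θ₀) = 0` for every `v`, then
`∫ F dN(v, θ) = 0` for every `θ ≥ θ₀` and every `v` (semigroup and Fubini). [folklore] -/
theorem pairing_eq_zero_of_le {F : V3 → ℝ} (hFc : Continuous F) {C : ℝ} (hC : ∀ u, |F u| ≤ C * (1 + ‖u‖ ^ 2))
    {θ₀ : ℝ} (hθ₀ : 0 ≤ θ₀) (h0 : ∀ v, ∫ u, F u ∂gaussMeasure v θ₀ = 0) {θ : ℝ} (hθ : θ₀ ≤ θ) (v : V3) :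
    ∫ u, F u ∂gaussMeasure v θ = 0 := by
  have hsplit : gaussMeasure v θ = gaussMeasure v (θ - θ₀) ∗ gaussMeasure (0 : V3) θ₀ := by
    rw [gaussMeasure_conv_gaussMeasure v (sub_nonneg.2 hθ) hθ₀, sub_add_cancel]
  have hint : Integrable F (gaussMeasure v θ) := integrable_gaussMeasure_of_quad hFc hC v θ
  rw [hsplit] at hint ⊢
  rw [integral_conv hint]
  have hinner : ∀ x : V3, ∫ y, F (x + y) ∂gaussMeasure (0 : V3) θ₀ = 0 := fun x => by
    have h := integral_map (μ := gaussMeasure (0 : V3) θ₀) (measurable_const_add x).aemeasurable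
      (hFc.aestronglyMeasurable (μ := (gaussMeasure (0 : V3) θ₀).map fun y => x + y))
    rw [gaussMeasure_map_const_add] at h
    rw [← h]
    exact h0 x
  simp only [hinner, integral_zero]

/-! ## Gaussian-times-polynomial integrability -/

/-- `(1 + |u|²)² e^{−r|u−v|²/2}` is integrable on `ℝ³` for `r > 0` (it is a multiple of the Maxwellian
`M_{1,1/r,v}` times `(1 + |u|²)²`). [folklore] -/
theorem integrable_sq_mul_exp_neg (v : V3) {r : ℝ} (hr : 0 < r) :
    Integrable (fun u : V3 => (1 + ‖u‖ ^ 2) ^ 2 * Real.exp (-r * (‖u - v‖ ^ 2 / 2))) := by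
  set c : ℝ := (2 * Real.pi * r⁻¹) ^ (-(Module.finrank ℝ V3 : ℝ) / 2) with hc
  have hc0 : 0 < c := Real.rpow_pos_of_pos (by positivity) _
  have hM : ∀ u : V3, Real.exp (-r * (‖u - v‖ ^ 2 / 2)) = c⁻¹ * localMaxwellian 1 r⁻¹ v u := by
    intro u
    rw [localMaxwellian, one_mul, ← hc, ← mul_assoc, inv_mul_cancel₀ hc0.ne', one_mul]
    congr 1
    field_simp
  have hint : Integrable (fun u : V3 => localMaxwellian 1 r⁻¹ v u * (1 + ‖u‖ ^ 2) ^ 2) :=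
    integrable_localMaxwellian_mul_of_abs_le (inv_pos.2 hr) v (by fun_prop) (K := 1) fun u => by
      rw [one_mul, abs_of_nonneg (by positivity)]
  refine (hint.const_mul c⁻¹).congr (Eventually.of_forall fun u => ?_)
  simp only [hM u]
  ring

/-- `|u − v|²/2 ≤ (1 + |v|²)(1 + |u|²)`. [folklore] -/
theorem half_norm_sub_sq_le (u v : V3) : ‖u - v‖ ^ 2 / 2 ≤ (1 + ‖v‖ ^ 2) * (1 + ‖u‖ ^ 2) := by
  have h1 : ‖u - v‖ ≤ ‖u‖ + ‖v‖ := norm_sub_le u v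
  have h2 : ‖u - v‖ ^ 2 ≤ (‖u‖ + ‖v‖) ^ 2 := pow_le_pow_left₀ (norm_nonneg _) h1 2
  nlinarith [sq_nonneg (‖u‖ - ‖v‖), sq_nonneg ‖u‖, sq_nonneg ‖v‖, mul_nonneg (sq_nonneg ‖u‖) (sq_nonneg ‖v‖)]

/-! ## Analytic continuation in the inverse variance -/

/-- **The unnormalised Gaussian pairing is holomorphic in the inverse variance.** For a continuous `F` of
quadratic growth and `v ∈ ℝ³`, `ρ ↦ ∫ F(u) e^{−ρ|u−v|²/2} du` is complex-differentiable on `{Re ρ > 0}`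
(differentiation under the integral sign). [folklore] -/
theorem differentiableOn_gaussPairing {F : V3 → ℝ} (hFc : Continuous F) {C : ℝ}
    (hC : ∀ u, |F u| ≤ C * (1 + ‖u‖ ^ 2)) (v : V3) :
    DifferentiableOn ℂ (fun ρ : ℂ => ∫ u : V3, (F u : ℂ) * cexp (-ρ * ((‖u - v‖ ^ 2 / 2 : ℝ) : ℂ)))
      {ρ : ℂ | 0 < ρ.re} := by
  intro ρ₀ hρ₀
  have hr : 0 < ρ₀.re := hρ₀
  have hC0 : 0 ≤ C := by
    have h := hC 0
    rw [norm_zero] at h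
    nlinarith [abs_nonneg (F 0)]
  set q : V3 → ℝ := fun u => ‖u - v‖ ^ 2 / 2 with hq
  have hq0 : ∀ u, 0 ≤ q u := fun u => by positivity
  set Fc : ℂ → V3 → ℂ := fun ρ u => (F u : ℂ) * cexp (-ρ * (q u : ℂ)) with hFc'
  set F' : ℂ → V3 → ℂ := fun ρ u => (F u : ℂ) * (cexp (-ρ * (q u : ℂ)) * (-(q u : ℂ))) with hF'
  have hqc : Continuous q := by fun_prop
  have hmeas : ∀ ρ : ℂ, AEStronglyMeasurable (Fc ρ) volume := fun ρ => by
    refine Continuous.aestronglyMeasurable ?_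
    exact (continuous_ofReal.comp hFc).mul (Complex.continuous_exp.comp
      (continuous_const.mul (continuous_ofReal.comp hqc)))
  have hmeas' : AEStronglyMeasurable (F' ρ₀) volume := by
    refine Continuous.aestronglyMeasurable ?_
    exact (continuous_ofReal.comp hFc).mul ((Complex.continuous_exp.comp
      (continuous_const.mul (continuous_ofReal.comp hqc))).mul (continuous_ofReal.comp hqc).neg)
  -- norm of the complex Gaussian
  have hnorm : ∀ (ρ : ℂ) (u : V3), ‖cexp (-ρ * (q u : ℂ))‖ = Real.exp (-ρ.re * q u) := fun ρ u => by
    rw [Complex.norm_exp]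
    congr 1
    simp only [neg_mul, Complex.neg_re, Complex.mul_re, Complex.ofReal_re, Complex.ofReal_im, mul_zero,
      sub_zero]
  -- the neighbourhood `Re ρ > r/2`
  set s : Set ℂ := Metric.ball ρ₀ (ρ₀.re / 2) with hs
  have hs_nhds : s ∈ 𝓝 ρ₀ := Metric.ball_mem_nhds _ (by positivity)
  have hs_re : ∀ x ∈ s, ρ₀.re / 2 ≤ x.re := fun x hx => by
    have h1 : |x.re - ρ₀.re| ≤ ‖x - ρ₀‖ := by
      have := Complex.abs_re_le_norm (x - ρ₀)
      rwa [Complex.sub_re] at this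
    have h2 : ‖x - ρ₀‖ < ρ₀.re / 2 := mem_ball_iff_norm.1 hx
    have h3 := (abs_lt.1 (h1.trans_lt h2)).1
    linarith
  -- domination of the derivative
  set bound : V3 → ℝ := fun u => C * (1 + ‖v‖ ^ 2) * ((1 + ‖u‖ ^ 2) ^ 2 *
    Real.exp (-(ρ₀.re / 2) * (‖u - v‖ ^ 2 / 2))) with hbound
  have hbound_int : Integrable bound volume :=
    (integrable_sq_mul_exp_neg v (by positivity : 0 < ρ₀.re / 2)).const_mul _
  have h_bound : ∀ᵐ u ∂(volume : Measure V3), ∀ x ∈ s, ‖F' x u‖ ≤ bound u := by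
    refine Eventually.of_forall fun u x hx => ?_
    have hxre := hs_re x hx
    rw [hF']
    dsimp only
    rw [norm_mul, norm_mul, norm_neg, hnorm, Complex.norm_real, Complex.norm_real, Real.norm_eq_abs,
      Real.norm_eq_abs, abs_of_nonneg (hq0 u), hbound]
    have e1 : Real.exp (-x.re * q u) ≤ Real.exp (-(ρ₀.re / 2) * (‖u - v‖ ^ 2 / 2)) := by
      rw [Real.exp_le_exp]
      show -x.re * (‖u - v‖ ^ 2 / 2) ≤ -(ρ₀.re / 2) * (‖u - v‖ ^ 2 / 2)
      nlinarith [hxre, sq_nonneg ‖u - v‖]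
    have e2 : q u ≤ (1 + ‖v‖ ^ 2) * (1 + ‖u‖ ^ 2) := half_norm_sub_sq_le u v
    calc |F u| * (Real.exp (-x.re * q u) * q u)
        ≤ C * (1 + ‖u‖ ^ 2) * (Real.exp (-(ρ₀.re / 2) * (‖u - v‖ ^ 2 / 2)) * ((1 + ‖v‖ ^ 2) * (1 + ‖u‖ ^ 2))) :=
          mul_le_mul (hC u) (mul_le_mul e1 e2 (hq0 u) (Real.exp_pos _).le) (by positivity) (by positivity)
      _ = C * (1 + ‖v‖ ^ 2) * ((1 + ‖u‖ ^ 2) ^ 2 * Real.exp (-(ρ₀.re / 2) * (‖u - v‖ ^ 2 / 2))) := by ring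
  -- integrability at `ρ₀`
  have hF_int : Integrable (Fc ρ₀) volume := by
    refine ((integrable_sq_mul_exp_neg v hr).const_mul C).mono' (hmeas ρ₀) (Eventually.of_forall fun u => ?_)
    rw [hFc']
    dsimp only
    rw [norm_mul, hnorm, Complex.norm_real, Real.norm_eq_abs]
    have e3 : 1 + ‖u‖ ^ 2 ≤ (1 + ‖u‖ ^ 2) ^ 2 := by nlinarith [sq_nonneg ‖u‖]
    calc |F u| * Real.exp (-ρ₀.re * q u) ≤ C * (1 + ‖u‖ ^ 2) * Real.exp (-ρ₀.re * q u) :=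
          mul_le_mul_of_nonneg_right (hC u) (Real.exp_pos _).le
      _ ≤ C * (1 + ‖u‖ ^ 2) ^ 2 * Real.exp (-ρ₀.re * q u) :=
          mul_le_mul_of_nonneg_right (mul_le_mul_of_nonneg_left e3 hC0) (Real.exp_pos _).le
      _ = C * ((1 + ‖u‖ ^ 2) ^ 2 * Real.exp (-ρ₀.re * (‖u - v‖ ^ 2 / 2))) := by rw [hq]; ring
  -- pointwise derivative
  have h_diff : ∀ᵐ u ∂(volume : Measure V3), ∀ x ∈ s, HasDerivAt (fun ρ => Fc ρ u) (F' x u) x := by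
    refine Eventually.of_forall fun u x _ => ?_
    have h1 : HasDerivAt (fun ρ : ℂ => -ρ * (q u : ℂ)) (-1 * (q u : ℂ)) x :=
      ((hasDerivAt_id x).neg).mul_const _
    have h2 := (h1.cexp).const_mul (F u : ℂ)
    have h3 : F' x u = (F u : ℂ) * (cexp (-x * (q u : ℂ)) * (-1 * (q u : ℂ))) := by
      simp only [hF', neg_mul, one_mul]
    rw [h3]
    exact h2
  exact (hasDerivAt_integral_of_dominated_loc_of_deriv_le hs_nhds (Eventually.of_forall hmeas) hF_int hmeas'
    h_bound hbound_int h_diff).2.differentiableAt.differentiableWithinAt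

/-- Real values of the complex pairing. [folklore] -/
theorem gaussPairing_ofReal (F : V3 → ℝ) (v : V3) (ρ : ℝ) :
    (∫ u : V3, (F u : ℂ) * cexp (-(ρ : ℂ) * ((‖u - v‖ ^ 2 / 2 : ℝ) : ℂ))) =
      ((∫ u : V3, F u * Real.exp (-ρ * (‖u - v‖ ^ 2 / 2)) : ℝ) : ℂ) := by
  rw [← integral_complex_ofReal]
  refine integral_congr_ae (Eventually.of_forall fun u => ?_)
  push_cast
  ring_nf

/-- The Gaussian pairing as an unnormalised integral: for `θ > 0`,
`∫ F dN(v, θ) = (2πθ)^{-3/2} ∫ F(u) e^{−θ⁻¹|u−v|²/2} du`. [folklore] -/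
theorem pairing_eq_const_mul (F : V3 → ℝ) {θ : ℝ} (hθ : 0 < θ) (v : V3) :
    ∫ u, F u ∂gaussMeasure v θ = (2 * Real.pi * θ) ^ (-(Module.finrank ℝ V3 : ℝ) / 2) *
      ∫ u : V3, F u * Real.exp (-θ⁻¹ * (‖u - v‖ ^ 2 / 2)) := by
  rw [← integral_localMaxwellian_mul_eq_integral_gaussMeasure hθ, ← integral_const_mul]
  refine integral_congr_ae (Eventually.of_forall fun u => ?_)
  simp only [localMaxwellian, one_mul]
  rw [show -‖u - v‖ ^ 2 / (2 * θ) = -θ⁻¹ * (‖u - v‖ ^ 2 / 2) by field_simp]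
  ring

/-- **All Gaussian pairings vanish once they vanish for large variances** (analytic continuation in the
inverse variance across the right half-plane). [folklore] -/
theorem pairing_eq_zero_of_all_ge {F : V3 → ℝ} (hFc : Continuous F) {C : ℝ}
    (hC : ∀ u, |F u| ≤ C * (1 + ‖u‖ ^ 2)) {θ₀ : ℝ} (hθ₀ : 0 < θ₀)
    (h0 : ∀ θ, θ₀ ≤ θ → ∀ v, ∫ u, F u ∂gaussMeasure v θ = 0) {θ : ℝ} (hθ : 0 < θ) (v : V3) :
    ∫ u, F u ∂gaussMeasure v θ = 0 := by
  set G : ℂ → ℂ := fun ρ => ∫ u : V3, (F u : ℂ) * cexp (-ρ * ((‖u - v‖ ^ 2 / 2 : ℝ) : ℂ)) with hG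
  have hGan : AnalyticOnNhd ℂ G {ρ : ℂ | 0 < ρ.re} :=
    (differentiableOn_gaussPairing hFc hC v).analyticOnNhd (isOpen_lt continuous_const Complex.continuous_re)
  -- real values of `G`
  have hGρ : ∀ ρ : ℝ, 0 < ρ → G (ρ : ℂ) =
      ((((2 * Real.pi * ρ⁻¹) ^ (-(Module.finrank ℝ V3 : ℝ) / 2))⁻¹ * ∫ u, F u ∂gaussMeasure v ρ⁻¹ : ℝ) : ℂ) := by
    intro ρ hρ
    have hc : (2 * Real.pi * ρ⁻¹) ^ (-(Module.finrank ℝ V3 : ℝ) / 2) ≠ 0 :=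
      (Real.rpow_pos_of_pos (by positivity) _).ne'
    simp only [hG]
    rw [gaussPairing_ofReal, pairing_eq_const_mul F (inv_pos.2 hρ) v, inv_inv, ← mul_assoc,
      inv_mul_cancel₀ hc, one_mul]
  have hGzero : ∀ ρ : ℝ, 0 < ρ → ρ ≤ θ₀⁻¹ → G (ρ : ℂ) = 0 := by
    intro ρ hρ hρle
    rw [hGρ ρ hρ, h0 ρ⁻¹ ((le_inv_comm₀ hρ hθ₀).1 hρle) v, mul_zero, Complex.ofReal_zero]
  -- the zeros accumulate at `z₀ = θ₀⁻¹/2` inside the half-plane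
  set z₀ : ℂ := ((θ₀⁻¹ / 2 : ℝ) : ℂ) with hz₀
  have hz₀U : z₀ ∈ {ρ : ℂ | 0 < ρ.re} := by
    simp only [hz₀, mem_setOf_eq, Complex.ofReal_re]
    positivity
  have hfreq : ∃ᶠ z in 𝓝[≠] z₀, G z = 0 := by
    set x : ℕ → ℝ := fun n => θ₀⁻¹ / 2 + θ₀⁻¹ / 2 * (1 / ((n : ℝ) + 1)) with hx
    have hxpos : ∀ n, 0 < x n := fun n => by positivity
    have hxle : ∀ n, x n ≤ θ₀⁻¹ := fun n => by
      have h1 : 1 / ((n : ℝ) + 1) ≤ 1 := by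
        rw [div_le_one (by positivity)]
        linarith [n.cast_nonneg (α := ℝ)]
      have h2 : 0 < θ₀⁻¹ := inv_pos.2 hθ₀
      simp only [hx]
      nlinarith
    have hxne : ∀ n, (x n : ℂ) ≠ z₀ := fun n => by
      simp only [hz₀, Ne, Complex.ofReal_inj, hx]
      have : 0 < θ₀⁻¹ / 2 * (1 / ((n : ℝ) + 1)) := by positivity
      linarith
    have hxt : Tendsto (fun n => ((x n : ℝ) : ℂ)) atTop (𝓝[≠] z₀) := by
      refine tendsto_nhdsWithin_iff.2 ⟨?_, Eventually.of_forall fun n => hxne n⟩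
      have h1 : Tendsto x atTop (𝓝 (θ₀⁻¹ / 2)) := by
        have h := ((tendsto_one_div_add_atTop_nhds_zero_nat (𝕜 := ℝ)).const_mul (θ₀⁻¹ / 2)).const_add
          (θ₀⁻¹ / 2)
        rwa [mul_zero, add_zero] at h
      exact (continuous_ofReal.tendsto _).comp h1
    exact hxt.frequently (Frequently.of_forall fun n => hGzero (x n) (hxpos n) (hxle n))
  have hEq := hGan.eqOn_zero_of_preconnected_of_frequently_eq_zero (convex_halfSpace_re_gt 0).isPreconnected
    hz₀U hfreq
  -- evaluate at `ρ = θ⁻¹`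
  have h1 : G ((θ⁻¹ : ℝ) : ℂ) = 0 := hEq (by
    simp only [mem_setOf_eq, Complex.ofReal_re]
    positivity)
  rw [hGρ θ⁻¹ (inv_pos.2 hθ), inv_inv, Complex.ofReal_eq_zero, mul_eq_zero] at h1
  rcases h1 with h1 | h1
  · exact absurd h1 (inv_ne_zero (Real.rpow_pos_of_pos (by positivity) _).ne')
  · exact h1

/-! ## The approximate identity and the deconvolution lemma -/

/-- **Gaussian approximate identity** on continuous functions of quadratic growth:
`∫ F dN(v, 1/(n+1)) → F(v)`. [folklore] -/
theorem tendsto_pairing_self {F : V3 → ℝ} (hFc : Continuous F) {C : ℝ}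
    (hC : ∀ u, |F u| ≤ C * (1 + ‖u‖ ^ 2)) (v : V3) :
    Tendsto (fun n : ℕ => ∫ u, F u ∂gaussMeasure v (1 / ((n : ℝ) + 1))) atTop (𝓝 (F v)) := by
  have hC0 : 0 ≤ C := by
    have h := hC 0
    rw [norm_zero] at h
    nlinarith [abs_nonneg (F 0)]
  have hθ : ∀ n : ℕ, (0 : ℝ) < 1 / ((n : ℝ) + 1) := fun n => Nat.one_div_pos_of_nat
  have heq : (fun n : ℕ => ∫ u, F u ∂gaussMeasure v (1 / ((n : ℝ) + 1))) =
      fun n : ℕ => ∫ w, F (v + Real.sqrt (1 / ((n : ℝ) + 1)) • w) ∂stdGaussian V3 :=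
    funext fun n => integral_gaussMeasure v (hθ n) F
  have hlim : F v = ∫ _w : V3, F v ∂stdGaussian V3 := by
    rw [integral_const, probReal_univ, one_smul]
  rw [heq, hlim]
  refine tendsto_integral_of_dominated_convergence (fun w => C * ((1 + 2 * ‖v‖ ^ 2) + 2 * ‖w‖ ^ 2))
    (fun n => ?_) ?_ (fun n => Eventually.of_forall fun w => ?_) (Eventually.of_forall fun w => ?_)
  · exact (hFc.comp (by fun_prop : Continuous fun w : V3 => v + Real.sqrt (1 / ((n : ℝ) + 1)) • w)).aestronglyMeasurable
  · have h2 : Integrable (fun w : V3 => ‖w‖ ^ 2) (stdGaussian V3) :=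
      (IsGaussian.memLp_id _ 2 (by simp)).integrable_norm_pow (by norm_num)
    exact ((integrable_const _).add (h2.const_mul 2)).const_mul C
  · rw [Real.norm_eq_abs]
    refine (hC _).trans (mul_le_mul_of_nonneg_left ?_ hC0)
    have h1 := EvenStressEnskog.norm_add_smul_sq_le v w (Real.sqrt (1 / ((n : ℝ) + 1)))
    rw [Real.sq_sqrt (hθ n).le] at h1
    have h3 : 1 / ((n : ℝ) + 1) ≤ 1 := by
      rw [div_le_one (by positivity)]
      linarith [n.cast_nonneg (α := ℝ)]
    have h4 : 2 * (1 / ((n : ℝ) + 1)) * ‖w‖ ^ 2 ≤ 2 * ‖w‖ ^ 2 := by nlinarith [sq_nonneg ‖w‖]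
    linarith
  · have hs : Tendsto (fun n : ℕ => Real.sqrt (1 / ((n : ℝ) + 1))) atTop (𝓝 0) := by
      have h := (Real.continuous_sqrt.tendsto 0).comp (tendsto_one_div_add_atTop_nhds_zero_nat (𝕜 := ℝ))
      rwa [Real.sqrt_zero] at h
    have h1 : Tendsto (fun n : ℕ => v + Real.sqrt (1 / ((n : ℝ) + 1)) • w) atTop (𝓝 (v + (0 : ℝ) • w)) :=
      tendsto_const_nhds.add (hs.smul tendsto_const_nhds)
    rw [zero_smul, add_zero] at h1
    exact (hFc.tendsto v).comp h1

/-- **Heat deconvolution lemma.** A continuous `F : ℝ³ → ℝ` of quadratic growth whose Gaussian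
coarse-graining `v ↦ ∫ φδ(v − u) F(u) du` (`φδ = M_{1,δ²,0}`, `δ > 0`) vanishes identically is identically
zero. [folklore] -/
theorem eq_zero_of_gaussian_conv_eq_zero {δ : ℝ} (hδ : 0 < δ) {F : V3 → ℝ} (hFc : Continuous F) {C : ℝ}
    (hC : ∀ u, |F u| ≤ C * (1 + ‖u‖ ^ 2)) (h0 : ∀ v, ∫ u, localMaxwellian 1 (δ ^ 2) 0 (v - u) * F u = 0)
    (v : V3) : F v = 0 := by
  have hδ2 : 0 < δ ^ 2 := by positivity
  have h0' : ∀ w, ∫ u, F u ∂gaussMeasure w (δ ^ 2) = 0 := fun w => by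
    rw [← integral_localMaxwellian_mul_eq_integral_gaussMeasure hδ2]
    simpa only [phi_sub_eq'] using h0 w
  have h1 : ∀ θ, δ ^ 2 ≤ θ → ∀ w, ∫ u, F u ∂gaussMeasure w θ = 0 := fun θ hθ w =>
    pairing_eq_zero_of_le hFc hC hδ2.le h0' hθ w
  have h2 : ∀ θ, 0 < θ → ∫ u, F u ∂gaussMeasure v θ = 0 := fun θ hθ =>
    pairing_eq_zero_of_all_ge hFc hC hδ2 h1 hθ v
  have h3 := tendsto_pairing_self hFc hC v
  have h4 : Tendsto (fun n : ℕ => ∫ u, F u ∂gaussMeasure v (1 / ((n : ℝ) + 1))) atTop (𝓝 0) := by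
    simp only [h2 _ Nat.one_div_pos_of_nat]
    exact tendsto_const_nhds
  exact tendsto_nhds_unique h3 h4

/-! ## Registered sub-goal -/

/-- **Registered sub-goal `stub_dissipationRigidityD` (helper D of `stub_dissipationRigidity`): the heat
deconvolution lemma — the Gaussian coarse-graining at scale `δ > 0` is injective on continuous functions of
quadratic growth.** [folklore] -/
theorem stub_dissipationRigidityD : ∀ {δ : ℝ}, 0 < δ → ∀ {F : V3 → ℝ}, Continuous F → ∀ {C : ℝ}, (∀ u, |F u| ≤ C * (1 + ‖u‖ ^ 2)) → (∀ v, ∫ u, localMaxwellian 1 (δ ^ 2) 0 (v - u) * F u = 0) → ∀ v, F v = 0 :=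
  fun hδ _ hFc _ hC h0 v => eq_zero_of_gaussian_conv_eq_zero hδ hFc hC h0 v

end Summit.AtomisticToContinuum.HydrodynamicLimit.Theorems.ChaosClosesEulerDissipationRigidity

end
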